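import Summits.QuantumFields.YangMills.Theorems.BalabanLadderUVSeamRecCeilingsGuardedPeelingLocalEvents
import HarnessLib

/-!
# Crux `UVSeamRec` (stmt-QuantumFields-20043), lane B: GUARDED large-field events — the b-adic parent chain, the telescoping of an unguarded
# large-field indicator into finitely many guarded ones, and their window-family law from the GUARDED one-box bound (GUCR)

Helper file (`--supports stmt-QuantumFields-20043`) of the width-lever seat `ym-20043-ceilings-p2` (lane B, gen 9); sequel of
`…CeilingsGuardedPeelingLocalEvents` (peeling engine for abstract local events attached to block-plaquettes).

THE POINT.  gen 6–8 reduce the large-field half of the (β) architecture of `stub_responseMomentsOdd6` to the ONE-BOX uniform conditional rarity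
bound (UCR_k): `kerE^η_{collar cube}(1_{blockField_k(y) ≥ ε}) ≤ w_k` for EVERY exterior `η` — and record its classical inconsistency below the
FLAT-PENETRATION floor: an exterior can force a coherent flux through the collar cube of side `(2m+1)b^k`, so thresholds must exceed
`≈ π⁴/(2(2m+1)⁴)` and the admissible threshold floor is tied to the collar `m` (g6 F2, g7 F2; `m` enters the budget as `3072(m+4)`).  That floor
is an artefact of the UNGUARDED event.  A coherent (smooth) flux that makes the level-`k` block plaquette at `y` large makes its b-adic `s`-PARENT
block plaquette (level `k+s`, block index `⌊y/b^s⌋`, same orientation) larger by the factor `b^{4s}` (for a uniform field the block-averaged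
`1 − re tr` scales with the fourth power of the block side), so the GUARDED event
`G(γ; e, ρ) := {blockField(γ) ≥ e} ∖ {blockField(parent_s γ) ≥ ρ·e}`   (`1 < ρ`, `ρ` below the coherence factor)
is NOT produced by coherent penetration: its one-box rarity (GUCR_k), asked over the collar cube of the PARENT, has no penetration floor.  And
nothing is lost: since `blockField ≤ 2`, the chain of parents with thresholds `ρ^j e` is EMPTY after `J` steps as soon as `ρ^J e > 2`, so
`1_{blockField(γ) ≥ e} ≤ Σ_{j<J} 1_{G(parent_s^j γ; ρ^j e, ρ)}`   (pointwise telescoping, `indicator_largeFieldEvent_le_sum_guarded`)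
— every unguarded indicator of the influence functional is dominated by `J = O(log(2/ε₀)/log ρ)` guarded ones, WITHOUT the `log R` that a naive
blame-the-parent recursion would cost.
* §1 b-adic arithmetic: `ediv_ediv_pow`, `chain_zero`, `chain_succ_y`, `ediv_ne_of_residue_eq` (parents of distinct blocks
  with the same residue are distinct).
* §2 the guarded event: measurability, TRUE SUPPORT inside the parent's support box `b^{k+s}⌊y/b^s⌋ + [0, 4b^{k+s})⁴`
  (`isCylinder_indicator_guarded_parentBox`), window of the parent block from the sign of the child's anchor (`parent_anchor_window`).
* §3 telescoping: `indicator_le_sum_indicator_sdiff` (abstract), `indicator_largeFieldEvent_le_sum_guarded`.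
* §4 `torusE_exp_sum_guarded_le_of_kernelBound` — for a family `F` of level-`k₀` block-plaquettes with one sign pattern and one residue of the block
  index mod `b^{(j+1)s}`, coefficients `t ≥ 0`, and the (GUCR) bound `w` at the child level `k₀ + js` for the threshold `e`:
  `⟨exp(Σ_{γ∈F} t_γ 1_{G(parent^j γ; e, ρ)}∘lift)⟩ ≤ exp((1/K)Σ(e^{Kt_γ} − 1)w)`, `K = 256(2m+4)⁴` (the engine of the prequel with `blk = parent^{j+1}`).
HONEST FRAMING.  Folklore (lattice arithmetic, DLR peeling); (GUCR_k) is an OPEN one-box large-field input of Bałaban's kind (R-operation currency,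
Dirichlet data) — conjecturally free of the penetration floor, NOT proved here; nothing of E0′; not a gap, not Clay.
References: folklore; T. Bałaban, Commun. Math. Phys. 122 (1989) 175–202, 355–392 (the inductive small/large-field structure across scales).
-/

set_option autoImplicit false

noncomputable section

open MeasureTheory Filter Topology Finset
open Literature.MathematicalPhysics.QuantumFieldTheory (GaugeConfig wilsonMeasure LatticeRep isProbabilityMeasure_wilsonMeasure
  measurable_torusLift)
open Literature.MathematicalPhysics.QuantumLattice (LGConfig torusLift IsCylinder ymSpecification isProbabilityMeasure_ymSpecification
  integrable_of_abs_le)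

namespace Summit.QuantumFields.YangMills.Cruxes.UVSeamRec.DLRPeeling

open Summit.QuantumFields.YangMills.Cruxes.OSLegsFromFemtoAndGap.DlrCollarTransfer
open Summit.QuantumFields.YangMills.Cruxes.UVSeamRec.PolymerData
open Summit.QuantumFields.YangMills.Cruxes.UVSeamRec.BlockFieldLocality

/-! ## §1 b-adic arithmetic of the parent chain -/

section Arithmetic

/-- Iterated b-adic parents: `y / b^a / b^c = y / b^{a+c}` (`b ≥ 0`). [folklore] -/
theorem ediv_ediv_pow (y b : ℤ) (hb : 0 ≤ b) (a c : ℕ) : y / b ^ a / b ^ c = y / b ^ (a + c) := by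
  rw [Int.ediv_ediv_of_nonneg (pow_nonneg hb a), pow_add]

/-- The `0`-th chain member is the block-plaquette itself. [folklore] -/
theorem chain_zero (𝔟 : BlockSize) (s : ℕ) (γ : Polymer) :
    (⟨γ.k + 0 * s, fun c => γ.y c / (𝔟.b : ℤ) ^ (0 * s), γ.μ, γ.ν, γ.hμν⟩ : Polymer) = γ := by
  obtain ⟨k, y, μ, ν, h⟩ := γ
  simp

/-- The block index of the `(j+1)`-st chain member is the `s`-parent of that of the `j`-th. [folklore] -/
theorem chain_succ_y (𝔟 : BlockSize) (s j : ℕ) (y : Fin 4 → ℤ) (c : Fin 4) :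
    y c / (𝔟.b : ℤ) ^ (j * s) / (𝔟.b : ℤ) ^ s = y c / (𝔟.b : ℤ) ^ ((j + 1) * s) := by
  rw [ediv_ediv_pow _ _ (Int.natCast_nonneg _), show j * s + s = (j + 1) * s by ring]

/-- **Distinct blocks with the same residue have distinct parents.**  If `y ≠ y'` and `y ≡ y'` coordinatewise modulo `n = b^{a}` with `d = b^{c}`,
`c ≤ a`, then `y/d ≠ y'/d` (coordinatewise functions). [folklore] -/
theorem ediv_ne_of_residue_eq {b : ℤ} (hb : 0 < b) {a c : ℕ} (hca : c ≤ a) {y y' : Fin 4 → ℤ} (hne : y ≠ y')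
    (hres : ∀ i, y i % b ^ a = y' i % b ^ a) : (fun i => y i / b ^ c) ≠ fun i => y' i / b ^ c := by
  intro h
  apply hne
  funext i
  have hi : y i / b ^ c = y' i / b ^ c := congrFun h i
  have hd0 : (b ^ c : ℤ) ≠ 0 := (pow_pos hb c).ne'
  -- `y i − y' i` is a multiple of `b^a`, hence of `b^c`
  have hdvd : (b ^ a : ℤ) ∣ y i - y' i := Int.ModEq.dvd ((hres i).symm) |> fun h => by simpa using h
  obtain ⟨q, hq⟩ := hdvd
  have hq' : y i = y' i + b ^ c * (b ^ (a - c) * q) := by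
    rw [← mul_assoc, ← pow_add, Nat.add_sub_cancel' hca]; linarith
  have hdiv : y i / b ^ c = y' i / b ^ c + b ^ (a - c) * q := by rw [hq', Int.add_mul_ediv_left _ _ hd0]
  have hzero : (b : ℤ) ^ (a - c) * q = 0 := by linarith
  rw [hq', hzero, mul_zero, add_zero]

end Arithmetic

/-! ## §2 The guarded event: measurability, true support inside the parent's box, the parent's window -/

section Guarded

variable {N : ℕ} [NeZero N]

/-- The guarded event is measurable. [folklore] -/
theorem measurableSet_guarded (𝔟 : BlockSize) (e e' : ℝ) (γ π : Polymer) :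
    MeasurableSet (largeFieldEvent (N := N) 𝔟 e γ \ largeFieldEvent (N := N) 𝔟 e' π) :=
  (measurableSet_largeFieldEvent (N := N) 𝔟 e γ).diff (measurableSet_largeFieldEvent (N := N) 𝔟 e' π)

omit [NeZero N] in
/-- A cylinder observable on `S` is a cylinder observable on every `S' ⊇ S`. [folklore] -/
theorem isCylinder_of_subset {α : Type*} {F : LGConfig 4 (Matrix.specialUnitaryGroup (Fin N) ℂ) → α}
    {S S' : Finset (Literature.MathematicalPhysics.QuantumLattice.ZdEdge 4)} (hF : IsCylinder F S) (hSS' : S ⊆ S') :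
    IsCylinder F S' := fun _ _ hUV => hF fun e he => hUV e (Finset.mem_coe.2 (hSS' (Finset.mem_coe.1 he)))

/-- **The child's support box sits in the parent's**: for `b ≥ 1`, `b^k·y + [0, 4b^k) ⊆ b^{k+s}·(y/b^s) + [0, 4b^{k+s})` coordinatewise. [folklore] -/
theorem childBox_subset_parentBox (𝔟 : BlockSize) (k s : ℕ) (y : Fin 4 → ℤ) :
    (Fintype.piFinset fun c => Finset.Ico ((𝔟.b : ℤ) ^ k * y c) ((𝔟.b : ℤ) ^ k * y c + 4 * (𝔟.b : ℤ) ^ k)) ×ˢ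
        (Finset.univ : Finset (Fin 4)) ⊆
      (Fintype.piFinset fun c => Finset.Ico ((𝔟.b : ℤ) ^ (k + s) * (y c / (𝔟.b : ℤ) ^ s))
        ((𝔟.b : ℤ) ^ (k + s) * (y c / (𝔟.b : ℤ) ^ s) + 4 * (𝔟.b : ℤ) ^ (k + s))) ×ˢ (Finset.univ : Finset (Fin 4)) := by
  intro e he
  rw [Finset.mem_product] at he ⊢
  refine ⟨Fintype.mem_piFinset.2 fun c => ?_, he.2⟩
  have hc := Finset.mem_Ico.1 (Fintype.mem_piFinset.1 he.1 c)
  rw [Finset.mem_Ico]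
  have hb : (0 : ℤ) < (𝔟.b : ℤ) := by exact_mod_cast 𝔟.pos
  have hbs : (0 : ℤ) < (𝔟.b : ℤ) ^ s := pow_pos hb s
  have hbk : (0 : ℤ) < (𝔟.b : ℤ) ^ k := pow_pos hb k
  have hbk1 : (1 : ℤ) ≤ (𝔟.b : ℤ) ^ k := 𝔟.one_le_pow k
  have h1 : (𝔟.b : ℤ) ^ s * (y c / (𝔟.b : ℤ) ^ s) ≤ y c := Int.mul_ediv_self_le hbs.ne'
  have h2 : y c < (𝔟.b : ℤ) ^ s * (y c / (𝔟.b : ℤ) ^ s) + (𝔟.b : ℤ) ^ s := Int.lt_mul_ediv_self_add hbs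
  have hpow : (𝔟.b : ℤ) ^ (k + s) = (𝔟.b : ℤ) ^ k * (𝔟.b : ℤ) ^ s := pow_add _ _ _
  -- multiply the division bounds by `b^k`
  have h1' : (𝔟.b : ℤ) ^ (k + s) * (y c / (𝔟.b : ℤ) ^ s) ≤ (𝔟.b : ℤ) ^ k * y c := by
    rw [hpow, mul_assoc]; exact mul_le_mul_of_nonneg_left h1 hbk.le
  have h2' : (𝔟.b : ℤ) ^ k * y c + (𝔟.b : ℤ) ^ k ≤ (𝔟.b : ℤ) ^ (k + s) * (y c / (𝔟.b : ℤ) ^ s) + (𝔟.b : ℤ) ^ (k + s) := by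
    have : (𝔟.b : ℤ) ^ k * (y c + 1) ≤ (𝔟.b : ℤ) ^ k * ((𝔟.b : ℤ) ^ s * (y c / (𝔟.b : ℤ) ^ s) + (𝔟.b : ℤ) ^ s) :=
      mul_le_mul_of_nonneg_left (by linarith) hbk.le
    rw [hpow]; nlinarith
  have hks : (𝔟.b : ℤ) ^ k ≤ (𝔟.b : ℤ) ^ (k + s) := by
    rw [hpow]; exact le_mul_of_one_le_right hbk.le (one_le_pow₀ (by exact_mod_cast 𝔟.one_le))
  constructor
  · exact h1'.trans hc.1
  · linarith [hc.2]

/-- **The true support of a guarded indicator**: the indicator of `largeFieldEvent e (k, y, μν) ∖ largeFieldEvent e' (k+s, y/b^s, μ'ν')` is a cylinder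
observable on the PARENT's support box `b^{k+s}(y/b^s) + [0, 4b^{k+s})⁴` (gen 7's `isCylinder_blockField_local` for both members). [folklore] -/
theorem isCylinder_indicator_guarded_parentBox (𝔟 : BlockSize) (e e' : ℝ) (k s : ℕ) (y : Fin 4 → ℤ) (μ ν : Fin 4) (h : μ < ν)
    (μ' ν' : Fin 4) (h' : μ' < ν') :
    IsCylinder ((largeFieldEvent (N := N) 𝔟 e ⟨k, y, μ, ν, h⟩ \
        largeFieldEvent (N := N) 𝔟 e' ⟨k + s, fun c => y c / (𝔟.b : ℤ) ^ s, μ', ν', h'⟩).indicator fun _ => (1 : ℝ))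
      ((Fintype.piFinset fun c => Finset.Ico ((𝔟.b : ℤ) ^ (k + s) * (y c / (𝔟.b : ℤ) ^ s))
        ((𝔟.b : ℤ) ^ (k + s) * (y c / (𝔟.b : ℤ) ^ s) + 4 * (𝔟.b : ℤ) ^ (k + s))) ×ˢ (Finset.univ : Finset (Fin 4))) := by
  classical
  intro U V hUV
  have hchild : blockField (N := N) 𝔟 k y μ ν h U = blockField (N := N) 𝔟 k y μ ν h V :=
    isCylinder_of_subset (isCylinder_blockField_local (N := N) 𝔟 k y μ ν h) (childBox_subset_parentBox 𝔟 k s y) hUV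
  have hpar : blockField (N := N) 𝔟 (k + s) (fun c => y c / (𝔟.b : ℤ) ^ s) μ' ν' h' U =
      blockField (N := N) 𝔟 (k + s) (fun c => y c / (𝔟.b : ℤ) ^ s) μ' ν' h' V :=
    isCylinder_blockField_local (N := N) 𝔟 (k + s) (fun c => y c / (𝔟.b : ℤ) ^ s) μ' ν' h' hUV
  simp only [Set.indicator_apply, Set.mem_sdiff, largeFieldEvent, Set.mem_setOf_eq, hchild, hpar]

omit [NeZero N] in
/-- **The parent's period window from the sign of the child's anchor.**  Level `k₀`, block index `y`, any `a` with `d = b^{a}`, parent level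
`k' = k₀ + a`, parent anchor `P_c = b^{k'}·(y_c/d) ∈ (b^{k₀}y_c − b^{k'}, b^{k₀}y_c]`; if `|b^{k₀} y_c| ≤ Bnd` and `Bnd + 2b^{k'} ≤ 2L+1` then with
`o_c = −b^{k'}` (when `0 ≤ b^{k₀}y_c`) resp. `o_c = −Bnd − b^{k'}` (otherwise): `o_c ≤ P_c` and `P_c + b^{k'} ≤ o_c + (2L+1)`. [folklore] -/
theorem parent_anchor_window (𝔟 : BlockSize) (k₀ a L : ℕ) {Bnd : ℤ} (y : Fin 4 → ℤ)
    (hbnd : ∀ c, |(𝔟.b : ℤ) ^ k₀ * y c| ≤ Bnd) (hroom : Bnd + 2 * (𝔟.b : ℤ) ^ (k₀ + a) ≤ 2 * L + 1) (c : Fin 4) :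
    (if 0 ≤ (𝔟.b : ℤ) ^ k₀ * y c then -(𝔟.b : ℤ) ^ (k₀ + a) else -Bnd - (𝔟.b : ℤ) ^ (k₀ + a)) ≤
        (𝔟.b : ℤ) ^ (k₀ + a) * (y c / (𝔟.b : ℤ) ^ a) ∧
      (𝔟.b : ℤ) ^ (k₀ + a) * (y c / (𝔟.b : ℤ) ^ a) + (𝔟.b : ℤ) ^ (k₀ + a) ≤
        (if 0 ≤ (𝔟.b : ℤ) ^ k₀ * y c then -(𝔟.b : ℤ) ^ (k₀ + a) else -Bnd - (𝔟.b : ℤ) ^ (k₀ + a)) + (2 * L + 1) := by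
  have hb : (0 : ℤ) < (𝔟.b : ℤ) := by exact_mod_cast 𝔟.pos
  have hba : (0 : ℤ) < (𝔟.b : ℤ) ^ a := pow_pos hb a
  have hbk : (0 : ℤ) < (𝔟.b : ℤ) ^ k₀ := pow_pos hb k₀
  have h1 : (𝔟.b : ℤ) ^ a * (y c / (𝔟.b : ℤ) ^ a) ≤ y c := Int.mul_ediv_self_le hba.ne'
  have h2 : y c < (𝔟.b : ℤ) ^ a * (y c / (𝔟.b : ℤ) ^ a) + (𝔟.b : ℤ) ^ a := Int.lt_mul_ediv_self_add hba
  have hpow : (𝔟.b : ℤ) ^ (k₀ + a) = (𝔟.b : ℤ) ^ k₀ * (𝔟.b : ℤ) ^ a := pow_add _ _ _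
  -- `P ∈ (A − b^{k'}, A]`
  have hP1 : (𝔟.b : ℤ) ^ (k₀ + a) * (y c / (𝔟.b : ℤ) ^ a) ≤ (𝔟.b : ℤ) ^ k₀ * y c := by
    rw [hpow, mul_assoc]; exact mul_le_mul_of_nonneg_left h1 hbk.le
  have hP2 : (𝔟.b : ℤ) ^ k₀ * y c < (𝔟.b : ℤ) ^ (k₀ + a) * (y c / (𝔟.b : ℤ) ^ a) + (𝔟.b : ℤ) ^ (k₀ + a) := by
    have : (𝔟.b : ℤ) ^ k₀ * y c < (𝔟.b : ℤ) ^ k₀ * ((𝔟.b : ℤ) ^ a * (y c / (𝔟.b : ℤ) ^ a) + (𝔟.b : ℤ) ^ a) :=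
      mul_lt_mul_of_pos_left h2 hbk
    rw [hpow]; nlinarith
  have habs := abs_le.1 (hbnd c)
  by_cases h0 : 0 ≤ (𝔟.b : ℤ) ^ k₀ * y c
  · simp only [h0, if_true]
    constructor <;> linarith
  · simp only [h0, if_false]
    push Not at h0
    constructor <;> linarith

end Guarded

/-! ## §3 Telescoping an unguarded indicator into guarded ones -/

section Telescoping

/-- **Abstract telescoping**: for sets `A_0, …, A_J` with `ω ∉ A_J`, `1_{A_0}(ω) ≤ Σ_{j<J} 1_{A_j ∖ A_{j+1}}(ω)` (let `j` be least with
`ω ∉ A_{j+1}`). [folklore] -/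
theorem indicator_le_sum_indicator_sdiff {Ω : Type*} (A : ℕ → Set Ω) (J : ℕ) (ω : Ω) (hJ : ω ∉ A J) :
    (A 0).indicator (fun _ => (1 : ℝ)) ω ≤ ∑ j ∈ Finset.range J, (A j \ A (j + 1)).indicator (fun _ => (1 : ℝ)) ω := by
  classical
  induction J with
  | zero =>
    simp only [Finset.range_zero, Finset.sum_empty, Set.indicator_of_notMem hJ, le_refl]
  | succ J ih =>
    rw [Finset.sum_range_succ]
    have hnn : ∀ j, 0 ≤ (A j \ A (j + 1)).indicator (fun _ => (1 : ℝ)) ω := fun j =>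
      Set.indicator_nonneg (fun _ _ => zero_le_one) _
    by_cases hJ' : ω ∈ A J
    · have hmem : ω ∈ A J \ A (J + 1) := ⟨hJ', hJ⟩
      have hlast : (A J \ A (J + 1)).indicator (fun _ => (1 : ℝ)) ω = 1 := Set.indicator_of_mem hmem _
      have h0 : (A 0).indicator (fun _ => (1 : ℝ)) ω ≤ 1 := Set.indicator_apply_le' (fun _ => le_rfl) (fun _ => zero_le_one)
      rw [hlast]
      linarith [Finset.sum_nonneg fun j (_ : j ∈ Finset.range J) => hnn j]
    · exact (ih hJ').trans (le_add_of_nonneg_right (hnn J))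

variable {N : ℕ} [NeZero N]

/-- **TELESCOPING A LARGE-FIELD INDICATOR INTO GUARDED ONES.**  Block size `𝔟`, guard depth `s`, ratio `ρ ≥ 0`, number of steps `J` with `ρ^J·e > 2`:
for every block-plaquette `γ = (k, y, μ<ν)` and configuration `η`,
`1_{largeFieldEvent e γ}(η) ≤ Σ_{j<J} 1_{largeFieldEvent (ρ^j e) (parent^j γ) ∖ largeFieldEvent (ρ^{j+1} e) (parent^{j+1} γ)}(η)`,
`parent^j γ = (k + js, y/b^{js}, μ<ν)` — the chain is EMPTY at step `J` because `blockField ≤ 2 < ρ^J e`. [folklore] -/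
theorem indicator_largeFieldEvent_le_sum_guarded (𝔟 : BlockSize) (s J : ℕ) {ρ e : ℝ} (hJ : 2 < ρ ^ J * e) (γ : Polymer)
    (η : LGConfig 4 (Matrix.specialUnitaryGroup (Fin N) ℂ)) :
    (largeFieldEvent (N := N) 𝔟 e γ).indicator (fun _ => (1 : ℝ)) η ≤
      ∑ j ∈ Finset.range J,
        (largeFieldEvent (N := N) 𝔟 (ρ ^ j * e) ⟨γ.k + j * s, fun c => γ.y c / (𝔟.b : ℤ) ^ (j * s), γ.μ, γ.ν, γ.hμν⟩ \
          largeFieldEvent (N := N) 𝔟 (ρ ^ (j + 1) * e)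
            ⟨γ.k + (j + 1) * s, fun c => γ.y c / (𝔟.b : ℤ) ^ ((j + 1) * s), γ.μ, γ.ν, γ.hμν⟩).indicator (fun _ => (1 : ℝ)) η := by
  have h := indicator_le_sum_indicator_sdiff
    (fun j => largeFieldEvent (N := N) 𝔟 (ρ ^ j * e) ⟨γ.k + j * s, fun c => γ.y c / (𝔟.b : ℤ) ^ (j * s), γ.μ, γ.ν, γ.hμν⟩) J η
    (by rw [largeFieldEvent_eq_empty_of_two_lt (N := N) 𝔟 hJ]; exact Set.notMem_empty η)
  have h0 : (⟨γ.k + 0 * s, fun c => γ.y c / (𝔟.b : ℤ) ^ (0 * s), γ.μ, γ.ν, γ.hμν⟩ : Polymer) = γ := chain_zero 𝔟 s γ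
  simp only [pow_zero, one_mul, h0] at h
  exact h

end Telescoping

/-! ## §4 The window-family law for guarded events from the guarded one-box bound (GUCR) -/

section Law

variable {N : ℕ} [NeZero N] (r : LatticeRep (Matrix.specialUnitaryGroup (Fin N) ℂ))

/-- **EXPONENTIAL MOMENTS OF A WEIGHTED COUNT OF GUARDED EVENTS ALONG THE `j`-TH CHAIN STEP, FROM (GUCR).**  `SU(N)`, any lattice representation,
any `β`; ANY odd block size `𝔟`, collar `m ≥ 3`, guard depth `s`, ratio `ρ`, origin level `k₀`, chain step `j`, parent level `k' = k₀ + (j+1)s` whose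
collar cube the torus holds (`(2m+1)b^{k'} + 3 ≤ 2L+1`); threshold `e` and weight `w ≥ 0` with the GUARDED ONE-BOX BOUND at the child level
`k₀ + js` for that threshold: for every block index `z`, orientation `μ<ν` and EVERY exterior `η`,
`kerE^η_{(b^{k'}(z/b^s − m), (2m+1)b^{k'})}(1_{largeFieldEvent e (k₀+js, z, μν) ∖ largeFieldEvent (ρe) (k', z/b^s, μν)}) ≤ w`.
A finite family `F` of level-`k₀` block-plaquettes with ONE residue of the block index modulo `b^{(j+1)s}` (so that `parent^{j+1}` is injective on `F`)
whose anchors satisfy `|b^{k₀}y_c| ≤ Bnd`, ONE sign pattern `σ` of the anchors, and `Bnd + 2b^{k'} ≤ 2L+1`; coefficients `t ≥ 0`.  Then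
`⟨exp(Σ_{γ∈F} t_γ·1_{largeFieldEvent e (parent^j γ) ∖ largeFieldEvent (ρe) (parent^{j+1} γ)}∘lift)⟩_{2L+1,β} ≤ exp((1/K)Σ_{γ∈F}(e^{Kt_γ} − 1)·w)`,
`K = 256(2m+4)⁴` — the prequel's `torusE_exp_sum_localEvent_le_of_kernelBound` with `blk = parent^{j+1}`.  HONEST FRAMING: reduction; (GUCR) is
the open input. [folklore] -/
theorem torusE_exp_sum_guarded_le_of_kernelBound (β : ℝ) (𝔟 : BlockSize) (m : ℕ) (hm : 3 ≤ m) (s : ℕ) (ρ : ℝ) (k₀ j L : ℕ)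
    (hfit : (2 * m + 1) * 𝔟.b ^ (k₀ + (j + 1) * s) + 3 ≤ 2 * L + 1) (e w : ℝ) (hw0 : 0 ≤ w)
    (hGUCR : ∀ (z : Fin 4 → ℤ) (μ ν : Fin 4) (h : μ < ν) (η : LGConfig 4 (Matrix.specialUnitaryGroup (Fin N) ℂ)),
      kerE (Matrix.specialUnitaryGroup (Fin N) ℂ) r β (fun c => (𝔟.b : ℤ) ^ (k₀ + (j + 1) * s) * (z c / (𝔟.b : ℤ) ^ s - m))
        ((2 * m + 1) * 𝔟.b ^ (k₀ + (j + 1) * s)) η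
        ((largeFieldEvent (N := N) 𝔟 e ⟨k₀ + j * s, z, μ, ν, h⟩ \
          largeFieldEvent (N := N) 𝔟 (ρ * e) ⟨k₀ + (j + 1) * s, fun c => z c / (𝔟.b : ℤ) ^ s, μ, ν, h⟩).indicator fun _ => (1 : ℝ)) ≤ w)
    (F : Finset Polymer) (hFk : ∀ γ ∈ F, γ.k = k₀)
    (hres : ∀ γ ∈ F, ∀ γ' ∈ F, ∀ c, γ.y c % (𝔟.b : ℤ) ^ ((j + 1) * s) = γ'.y c % (𝔟.b : ℤ) ^ ((j + 1) * s))
    {Bnd : ℤ} (hbnd : ∀ γ ∈ F, ∀ c, |(𝔟.b : ℤ) ^ k₀ * γ.y c| ≤ Bnd) (hroom : Bnd + 2 * (𝔟.b : ℤ) ^ (k₀ + (j + 1) * s) ≤ 2 * L + 1)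
    (σ : Fin 4 → Bool) (hσ : ∀ γ ∈ F, ∀ c, decide (0 ≤ (𝔟.b : ℤ) ^ k₀ * γ.y c) = σ c)
    (t : Polymer → ℝ) (ht : ∀ γ ∈ F, 0 ≤ t γ) :
    torusE (Matrix.specialUnitaryGroup (Fin N) ℂ) r β L (fun U => Real.exp (∑ γ ∈ F,
        t γ * (largeFieldEvent (N := N) 𝔟 e ⟨k₀ + j * s, fun c => γ.y c / (𝔟.b : ℤ) ^ (j * s), γ.μ, γ.ν, γ.hμν⟩ \
          largeFieldEvent (N := N) 𝔟 (ρ * e)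
            ⟨k₀ + (j + 1) * s, fun c => γ.y c / (𝔟.b : ℤ) ^ ((j + 1) * s), γ.μ, γ.ν, γ.hμν⟩).indicator (fun _ => (1 : ℝ)) U)) ≤
      Real.exp ((1 : ℝ) / (256 * (2 * m + 4) ^ 4) * ∑ γ ∈ F, (Real.exp (256 * (2 * m + 4) ^ 4 * t γ) - 1) * w) := by
  classical
  have hb : (0 : ℤ) < (𝔟.b : ℤ) := by exact_mod_cast 𝔟.pos
  -- the attachment `blk = parent^{j+1}` and the events
  set blk : Polymer → Polymer := fun γ =>
    ⟨k₀ + (j + 1) * s, fun c => γ.y c / (𝔟.b : ℤ) ^ ((j + 1) * s), γ.μ, γ.ν, γ.hμν⟩ with hblk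
  set E : Polymer → Set (LGConfig 4 (Matrix.specialUnitaryGroup (Fin N) ℂ)) := fun γ =>
    largeFieldEvent (N := N) 𝔟 e ⟨k₀ + j * s, fun c => γ.y c / (𝔟.b : ℤ) ^ (j * s), γ.μ, γ.ν, γ.hμν⟩ \
      largeFieldEvent (N := N) 𝔟 (ρ * e) ⟨k₀ + (j + 1) * s, fun c => γ.y c / (𝔟.b : ℤ) ^ ((j + 1) * s), γ.μ, γ.ν, γ.hμν⟩ with hE
  -- injectivity of `blk` on `F` (one residue class)
  have hinj : Set.InjOn blk F := by
    intro γ hγ γ' hγ' hbb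
    have hγF := Finset.mem_coe.1 hγ
    have hγ'F := Finset.mem_coe.1 hγ'
    by_contra hne
    have hμ : γ.μ = γ'.μ := by have := congrArg Polymer.μ hbb; simpa [hblk] using this
    have hν : γ.ν = γ'.ν := by have := congrArg Polymer.ν hbb; simpa [hblk] using this
    have hk : γ.k = γ'.k := by rw [hFk γ hγF, hFk γ' hγ'F]
    have hy : γ.y ≠ γ'.y := by
      intro hy
      apply hne
      obtain ⟨k1, y1, μ1, ν1, h1⟩ := γ
      obtain ⟨k2, y2, μ2, ν2, h2⟩ := γ'
      simp only at hk hy hμ hν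
      subst hk; subst hy; subst hμ; subst hν
      rfl
    have hyblk : (fun c => γ.y c / (𝔟.b : ℤ) ^ ((j + 1) * s)) = fun c => γ'.y c / (𝔟.b : ℤ) ^ ((j + 1) * s) := by
      have := congrArg Polymer.y hbb; simpa [hblk] using this
    exact ediv_ne_of_residue_eq hb le_rfl hy (hres γ hγF γ' hγ'F) hyblk
  -- the window of the parents
  set o : Fin 4 → ℤ := fun c =>
    if σ c then -(𝔟.b : ℤ) ^ (k₀ + (j + 1) * s) else -Bnd - (𝔟.b : ℤ) ^ (k₀ + (j + 1) * s) with ho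
  have hwin : ∀ γ ∈ F, ∀ c, o c ≤ anchor 𝔟 (blk γ) c ∧
      anchor 𝔟 (blk γ) c + (𝔟.b : ℤ) ^ (k₀ + (j + 1) * s) ≤ o c + (2 * L + 1) := by
    intro γ hγ c
    have hw := parent_anchor_window 𝔟 k₀ ((j + 1) * s) L γ.y (hbnd γ hγ) hroom c
    have hanc : anchor 𝔟 (blk γ) c = (𝔟.b : ℤ) ^ (k₀ + (j + 1) * s) * (γ.y c / (𝔟.b : ℤ) ^ ((j + 1) * s)) := by
      simp only [anchor, hblk]
    have hoc : o c = if 0 ≤ (𝔟.b : ℤ) ^ k₀ * γ.y c then -(𝔟.b : ℤ) ^ (k₀ + (j + 1) * s)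
        else -Bnd - (𝔟.b : ℤ) ^ (k₀ + (j + 1) * s) := by
      simp only [ho, ← hσ γ hγ c, decide_eq_true_eq]
    rw [hanc, hoc]
    exact hw
  -- the hypotheses of the engine
  have hEm : ∀ γ ∈ F, MeasurableSet (E γ) := fun γ _ =>
    measurableSet_guarded (N := N) 𝔟 e (ρ * e) _ _
  have hEloc : ∀ γ ∈ F, IsCylinder ((E γ).indicator fun _ => (1 : ℝ))
      ((Fintype.piFinset fun c => Finset.Ico ((𝔟.b : ℤ) ^ (blk γ).k * (blk γ).y c)
        ((𝔟.b : ℤ) ^ (blk γ).k * (blk γ).y c + 4 * (𝔟.b : ℤ) ^ (blk γ).k)) ×ˢ (Finset.univ : Finset (Fin 4))) := by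
    intro γ _
    have hc := isCylinder_indicator_guarded_parentBox (N := N) 𝔟 e (ρ * e) (k₀ + j * s) s
      (fun c => γ.y c / (𝔟.b : ℤ) ^ (j * s)) γ.μ γ.ν γ.hμν γ.μ γ.ν γ.hμν
    have e1 : k₀ + j * s + s = k₀ + (j + 1) * s := by ring
    simp only [chain_succ_y, e1] at hc
    exact hc
  have hker : ∀ γ ∈ F, ∀ η : LGConfig 4 (Matrix.specialUnitaryGroup (Fin N) ℂ),
      kerE (Matrix.specialUnitaryGroup (Fin N) ℂ) r β (fun c => (𝔟.b : ℤ) ^ (k₀ + (j + 1) * s) * ((blk γ).y c - m))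
        ((2 * m + 1) * 𝔟.b ^ (k₀ + (j + 1) * s)) η ((E γ).indicator fun _ => (1 : ℝ)) ≤ w := by
    intro γ _ η
    have hg := hGUCR (fun c => γ.y c / (𝔟.b : ℤ) ^ (j * s)) γ.μ γ.ν γ.hμν η
    simp only [chain_succ_y] at hg
    exact hg
  exact torusE_exp_sum_localEvent_le_of_kernelBound r β 𝔟 m hm (k₀ + (j + 1) * s) L hfit F blk hinj (fun _ _ => rfl) E
    hEm hEloc (fun _ => w) (fun _ _ => hw0) hker o hwin t ht

end Law

end Summit.QuantumFields.YangMills.Cruxes.UVSeamRec.DLRPeeling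

end
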